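import Summits.QuantumAdvantage.QuantumAdvantage.Theorems.SosSandwichTransferPBKeyedLanguage
import Literature.Computability.QuantumComplexity.KeyedOracleFamilyUniform
import HarnessLib

/-!
# Crux `TransferPB` (stmt-QuantumAdvantage-15238, route SosSandwich), line `birth` — the keyed estimator family of the node tests is UNIFORM

Obligation (Q) of stub `stub_pbOracleSimulation` (`nodeProblem F r c k ∈ PromiseBQP`). The estimator of the node tests
is the keyed-oracle family `(keyedRun F nOf h).family` (`Theorems/SosSandwichTransferPBKeyedLanguage.lean`; oracle
`keyedLang F`; `|key| = keyPoly (2T(n) + n + anc(n))` key wires for `n = nOf L`). By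
`Literature/…/KeyedOracleFamilyUniform.lean` (`KeyedRun.family_isUniform`) it is polynomial-time uniform as soon as `F`
is uniform and the two size functions are computed in polynomial time on unary numerals. This file discharges the size
functions:

* `oracleQueries_eq_length_flatten` — the number of oracle gates of a circuit, read off its raw gates (tag bit `1`);
  **`codeFP_oracleQueries_un`** — for uniform `F`, `n ↦ T(n)` is computed on unary codes (from the raw description
  `codeFP_rawDesc`: map each raw gate to `[()]`/`[]` by its tag, flatten, length);
* `codeFP_kOf_un`, `codeFP_mOf_un` (the ancilla field of `codeFP_rawDesc`), **`codeFP_keyWidth`** —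
  `n ↦ keyPoly (kOf F n + mOf F n)` in unary (the polynomial brick `polyFn keyPoly`);
* **`keyedRun_family_isUniform`** — for uniform `F` and `CodeFP unE unE nOf`, the keyed estimator family
  `(keyedRun F nOf h).family` is uniform (with `Theorems/SosSandwichTransferPBLayoutFP.lean`'s `codeFP_nOfLayout` this is
  the MEAN estimator on laid-out instances).

All proved; no definition with computational content beyond string functions; no named fact. Sources: C. H. Bennett,
E. Bernstein, G. Brassard, U. Vazirani, SIAM J. Comput. 26 (1997), Thm. 4.14; S. Arora, B. Barak, Computational
Complexity (CUP 2009), §6.2 Remark 6.7, §1.3.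
-/

-- D-0017: single-conjunct summit ⇒ the duplicate `QuantumAdvantage.QuantumAdvantage` is mandated.
set_option linter.dupNamespace false

noncomputable section

namespace Summit.QuantumAdvantage.QuantumAdvantage.Cruxes.TransferPB.Birth

open Finset Literature.Computability.Cryptography Literature.Computability.Complexity
  Literature.Computability.Complexity.Brick Literature.Computability.Complexity.Plumb
  Literature.Computability.QuantumComplexity Literature.Computability.QuantumComplexity.ClassicalSimulation
  Literature.Computability.Cryptography.ExplicitKWiseHash
open _root_.Computability Polynomial CodeFP

namespace SimTreePB

/-! ### The oracle count on unary codes -/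

/-- The unit flag of a raw gate: `[()]` for an oracle query, `[]` for a gate symbol. -/
def tagFlag (γ : RawGate) : List Unit := if γ.1 then [()] else []

/-- **The number of oracle gates of a gate list, read off its raw gates.** -/
theorem filter_length_eq_flatten {G : QGateSet} [Encodable G.Op] {N : ℕ} :
    ∀ gs : List (QGate G N),
      (gs.filter fun g => ¬ g.IsOracleFree).length = ((gs.map QGate.toRaw).map tagFlag).flatten.length
  | [] => rfl
  | g :: gs => by
    have ih := filter_length_eq_flatten gs
    rw [List.map_cons, List.map_cons, List.flatten_cons, List.length_append, ← ih, List.filter_cons]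
    cases g with
    | gate g e =>
      have h1 : decide (¬ (QGate.gate g e : QGate G N).IsOracleFree) = false := by simp [QGate.IsOracleFree]
      rw [h1]
      simp [QGate.toRaw, tagFlag]
    | oracle k e =>
      have h1 : decide (¬ (QGate.oracle k e : QGate G N).IsOracleFree) = true := by simp [QGate.IsOracleFree]
      rw [h1]
      simp [QGate.toRaw, tagFlag, Nat.add_comm]

/-- The oracle count of the `n`-th circuit through the raw description. -/
theorem oracleQueries_eq_length_flatten (F : QCircuitFamily cliffordT) (n : ℕ) :
    (F.circ n).oracleQueries = (((F.rawDesc n).2.2).map tagFlag).flatten.length := by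
  rw [QCircuit.oracleQueries, filter_length_eq_flatten]
  rfl

/-- `tagFlag` is computed on codes. -/
theorem codeFP_tagFlag : CodeFP RawGate.E (rawE unitE) tagFlag :=
  (RawGate.codeFP_tag.ite (const _ [()]) (const _ [])).congr fun γ => by simp [tagFlag]

variable (F : QCircuitFamily cliffordT)

/-- **For a uniform family, `n ↦ T(n)` (the number of oracle gates of `F.circ n`) is computed on unary codes.** -/
theorem codeFP_oracleQueries_un (hF : F.IsUniform) : CodeFP unE unE (fun n => (F.circ n).oracleQueries) := by
  have hgs : CodeFP unE (rawE RawGate.E) (fun n => (F.rawDesc n).2.2) := (codeFP_rawDesc hF).snd'.snd'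
  have h : CodeFP unE unE (fun n => (((F.rawDesc n).2.2).map tagFlag).flatten.length) :=
    (ulength unitE).comp ((flatten unitE).comp ((map₀ codeFP_tagFlag).comp hgs))
  exact h.congr fun n => (oracleQueries_eq_length_flatten F n).symm

/-- `n ↦ kOf F n = 2T(n)` on unary codes. -/
theorem codeFP_kOf_un (hF : F.IsUniform) : CodeFP unE unE (kOf F) :=
  (unAdd.comp ((codeFP_oracleQueries_un F hF).pair (codeFP_oracleQueries_un F hF))).congr fun n => by
    simp [kOf]; ring

/-- `n ↦ mOf F n = n + ancillas n` on unary codes. -/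
theorem codeFP_mOf_un (hF : F.IsUniform) : CodeFP unE unE (mOf F) :=
  (unAdd.comp ((CodeFP.id unE).pair (codeFP_rawDesc hF).snd'.fst')).congr fun _ => rfl

/-- **The key width `n ↦ keyPoly (kOf F n + mOf F n)` on unary codes** (the polynomial brick `polyFn keyPoly`, as in
`Regev2009.GIVPPost.polyEval_codeFP`). -/
theorem codeFP_keyWidth (hF : F.IsUniform) : CodeFP unE unE (fun n => keyPoly.eval (kOf F n + mOf F n)) := by
  have hpoly : CodeFP unE unE (fun m => keyPoly.eval m) :=
    of_fn (polyFn keyPoly) (polyFn_mem_FP keyPoly) fun m => by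
      rw [polyFn_apply, unE_eq_ones, unE_eq_ones]
      simp [ones]
  exact hpoly.comp (unAdd.comp ((codeFP_kOf_un F hF).pair (codeFP_mOf_un F hF)))

/-! ### Uniformity of the keyed estimator family -/

/-- **The keyed estimator family of the node tests is polynomial-time uniform** for a uniform `F` and an input-length
function computed on unary codes. [cite: BennettBernsteinBrassardVazirani1997, Thm. 4.14]
[cite: AroraBarak2009, §6.2 Remark 6.7] -/
theorem keyedRun_family_isUniform (hF : F.IsUniform) {nOf : ℕ → ℕ} (h : ∀ L, nOf L ≤ L) (hn : CodeFP unE unE nOf) :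
    (keyedRun F nOf h).family.IsUniform :=
  (keyedRun F nOf h).family_isUniform hF hn ((codeFP_keyWidth F hF).comp hn)

end SimTreePB

end Summit.QuantumAdvantage.QuantumAdvantage.Cruxes.TransferPB.Birth

end
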